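import Mathlib.Data.Real.Basic
import Mathlib.Tactic.Linarith
import Mathlib.Tactic.Positivity
import Mathlib.Tactic.FieldSimp
import Mathlib.Tactic.Ring
import HarnessLib

/-!
# QUANT lane R8, T-DEC, (II) `ConvClosedTResidue`: the TOP-FLIPPED PIECE INEQUALITY (TFP) — the giant budget of a top-flipped
# two-blob piece is met whenever neither raised rate is light; pure real algebra (the core of piece lemma P1 of FOR-PROVERS-CONV-PIECES §6)

builds on p205010 (kernel theorem, internal audit signed; external expert review pending)

Support file (`--supports stmt-CriticalPhenomena-4575`), QUANT lane LEAD seat prim-quant-lead (gen 26), rung R8 of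
`run/shared/lean/prim/quant/LADDER.md`.  Memo `run/shared/lean/prim/quant/FOR-PROVERS-CONV-PIECES.md` §4, LEAD-NOTES-G26 N66/N70.
Pure real algebra: theorems only, standard axioms, no sorries, imports only Mathlib tactics (pattern of `…QuantLightTwoBlobPolyA`).

THE PIECE.  A component `σ = {a, a′; g₁}` of one factor's top datum and a component `τ = {b, b′; g₂}` of the other's give the 4-cell piece
`(1−g₁)(1−g₂)·δ_{a+b} + (1−g₁)g₂·δ_{a+b′} + g₁(1−g₂)·δ_{a′+b} + g₁g₂·δ_{a′+b′}` at the joint target `T`.  TOP-FLIPPED shape (`LMMG`):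
`a+b` is the only low (deficit `S := T − 2(a+b) > 0`), the cross cells `a+b′`, `a′+b` are mids (`2(a+b′) ≥ T`, `2(a′+b) ≥ T`), the top cell
`a′+b′ > j` is a giant.  Spans `D = a′ − a`, `E = b′ − b`; the RAISED rates of the two conv pairs out of the low cell are `t₁ = S/D` (into `a′+b`)
and `t₂ = S/E` (into `a+b′`); "no light raised rate" = `x·D ≤ S` and `x·E ≤ S`; "compatible" = `S < D`, `S < E` (then the raised usages are
`S/(D−S)`, `S/(E−S)`).  CREDITS: `σ` valid at its target means `κ_x(g₁)·D ≥ d₁ := T₁ − 2a`, likewise `κ_x(g₂)·E ≥ e₂`, and `S = d₁ + e₂` (or `≤`),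
where `κ_x(g) = min(g, (g − x²)/(1−x))` is the ARCH credit rate (`g` for heavy `g ≥ x`, `(g−x²)/(1−x)` for light) — encoded below by a real `κᵢ` with
`κᵢ ≤ gᵢ` and `(1−x)κᵢ ≤ gᵢ − x²`.
THE FLOW (lead g26 "retention at unraised loads"): ship from the low cell `g₁(1−g₂)(D−S)/S` into `a′+b` (this loads that mid by exactly its mass
`g₁(1−g₂)`) and `(1−g₁)g₂(E−S)/S` into `a+b′`, the rest to the giant at rate `x/(1−x)`.  The ONLY inequality left is the giant budget
`(x/(1−x))·[(1−g₁)(1−g₂) − g₁(1−g₂)(D−S)/S − (1−g₁)g₂(E−S)/S] ≤ g₁g₂`, which is EQUIVALENT to the linear inequality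
**TFP: `(x − g₁g₂)·S ≤ x·(g₁(1−g₂)·D + (1−g₁)g₂·E)`** (`tfp_giant_budget_of_core`).
THE THEOREM (`tfp_core`): TFP holds for all gates `x² ≤ gᵢ ≤ 1` and all spans under the credit bound `S ≤ κ₁D + κ₂E` and the regime bounds
`xD ≤ S`, `xE ≤ S` — heavy⊗heavy and light⊗light termwise (`tfp_core_termD_heavy/_light`), light⊗heavy using `xD ≤ S` (`tfp_core_LH`).
So the top-flipped piece is standalone DEC in every regime without a light raised rate (the packaging into `DECAtT` — a `twoBlob_decAtT_of_zeroFlow`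
variant with the top cell a giant, then `decAtT_shift_two` — is recorded for the typer/arm seats in FOR-PROVERS-CONV-PIECES §6).  EVIDENCE for the
regime statement (before the proof): 3·10⁶ random (x, ρ_σ, ρ_τ, r ≤ 2⁷) / 0 failures in the regimes hh/hi/ih/ii for all four type pairs; the MIXED
regimes (one raised rate light) do fail at span ratios ≳ 25 (light⊗light) / ≳ 10 (light⊗heavy) — not covered here, by design.
EQUALITY: `g₁ = g₂ = x`, `S = x(D+E)` (both pairs at the light/heavy boundary) — pattern α's tight limit (LEAD-NOTES-G26 N63/N66).

[this work]; FOR-PROVERS-CONV-PIECES (lead g26), CONV-RESIDUE-G21 §8 (census-1 g21: the span-ratio threshold seen from the LS side) (this lane).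
Nothing here is cited as a published result.  The gluing rows served [cite: KozmaNitzan2024, Conjecture 3 (p. 15)]; product measure
[cite: Grimmett1999, §1.3 p. 10].
-/

namespace Summit.CriticalPhenomena.PercolationContinuityZ3.Theorems

namespace Quant

namespace LawDec

/-! ### The D-term and the E-term of TFP -/

/-- **heavy D-term**: `0 ≤ x ≤ g₁`, `κ₁ ≤ g₁` ⟹ `(x − g₁g₂)κ₁ ≤ x·g₁(1−g₂)` whenever `g₁g₂ ≤ x` (`0 ≤ g₂`). [this work] -/
theorem tfp_termD_heavy (x g₁ g₂ κ₁ : ℝ) (hx0 : 0 ≤ x) (hxg : x ≤ g₁) (hκ : κ₁ ≤ g₁) (hg₂ : 0 ≤ g₂) (hprod : g₁ * g₂ ≤ x) :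
    (x - g₁ * g₂) * κ₁ ≤ x * (g₁ * (1 - g₂)) := by
  have hg₁0 : 0 ≤ g₁ := le_trans hx0 hxg
  have h1 : (x - g₁ * g₂) * κ₁ ≤ (x - g₁ * g₂) * g₁ := mul_le_mul_of_nonneg_left hκ (by linarith)
  -- x·g₁(1−g₂) − (x − g₁g₂)g₁ = g₁g₂(g₁ − x) ≥ 0
  have key : x * (g₁ * (1 - g₂)) - (x - g₁ * g₂) * g₁ = g₁ * g₂ * (g₁ - x) := by ring
  have h2 : 0 ≤ g₁ * g₂ * (g₁ - x) := mul_nonneg (mul_nonneg hg₁0 hg₂) (sub_nonneg.2 hxg)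
  linarith

/-- **light D-term**: `x² ≤ g₁ ≤ x`, `g₂ ≤ x`, `(1−x)κ₁ ≤ g₁ − x²`, `0 < x < 1` ⟹ `(x − g₁g₂)κ₁ ≤ x·g₁(1−g₂)` — via the factorisation
`x(1−x)g₁(1−g₂) − (x − g₁g₂)(g₁ − x²) = (x − g₁)(x² − g₁g₂)`. [this work] -/
theorem tfp_termD_light (x g₁ g₂ κ₁ : ℝ) (hx0 : 0 < x) (hx1 : x < 1) (hg₁ : x ^ 2 ≤ g₁) (hg₁x : g₁ ≤ x) (hg₂0 : 0 ≤ g₂) (hg₂x : g₂ ≤ x)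
    (hκ : (1 - x) * κ₁ ≤ g₁ - x ^ 2) :
    (x - g₁ * g₂) * κ₁ ≤ x * (g₁ * (1 - g₂)) := by
  have hprod : g₁ * g₂ ≤ x ^ 2 := by
    have h1 : g₁ * g₂ ≤ x * g₂ := mul_le_mul_of_nonneg_right hg₁x hg₂0
    have h2 : x * g₂ ≤ x * x := mul_le_mul_of_nonneg_left hg₂x hx0.le
    nlinarith
  have hxp : x ^ 2 ≤ x := by nlinarith
  have hpos : 0 ≤ x - g₁ * g₂ := by nlinarith
  -- (1−x)·[(x − g₁g₂)κ₁] ≤ (x − g₁g₂)(g₁ − x²) ≤ x(1−x)g₁(1−g₂)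
  have h1 : (1 - x) * ((x - g₁ * g₂) * κ₁) ≤ (x - g₁ * g₂) * (g₁ - x ^ 2) := by
    have := mul_le_mul_of_nonneg_left hκ hpos
    linarith [this]
  have key : x * (1 - x) * (g₁ * (1 - g₂)) - (x - g₁ * g₂) * (g₁ - x ^ 2) = (x - g₁) * (x ^ 2 - g₁ * g₂) := by ring
  have h2 : (x - g₁ * g₂) * (g₁ - x ^ 2) ≤ x * (1 - x) * (g₁ * (1 - g₂)) := by
    have : 0 ≤ (x - g₁) * (x ^ 2 - g₁ * g₂) := mul_nonneg (by linarith) (by linarith)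
    linarith
  have h3 : (1 - x) * ((x - g₁ * g₂) * κ₁) ≤ (1 - x) * (x * (g₁ * (1 - g₂))) := by linarith
  exact le_of_mul_le_mul_left h3 (by linarith)

/-! ### TFP by type -/

/-- **TFP, heavy ⊗ heavy** (`x ≤ g₁`, `x ≤ g₂`): termwise. [this work] -/
theorem tfp_core_HH (x g₁ g₂ κ₁ κ₂ S D E : ℝ) (hx0 : 0 < x) (hg₁ : x ≤ g₁) (hg₁1 : g₁ ≤ 1) (hg₂ : x ≤ g₂) (hg₂1 : g₂ ≤ 1)
    (hκ₁ : κ₁ ≤ g₁) (hκ₂ : κ₂ ≤ g₂) (hD : 0 ≤ D) (hE : 0 ≤ E) (hS : 0 ≤ S) (hcred : S ≤ κ₁ * D + κ₂ * E) :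
    (x - g₁ * g₂) * S ≤ x * (g₁ * (1 - g₂) * D + (1 - g₁) * g₂ * E) := by
  have hR : 0 ≤ x * (g₁ * (1 - g₂) * D + (1 - g₁) * g₂ * E) :=
    mul_nonneg hx0.le (add_nonneg (mul_nonneg (mul_nonneg (by linarith) (by linarith)) hD)
      (mul_nonneg (mul_nonneg (by linarith) (by linarith)) hE))
  by_cases hp : x ≤ g₁ * g₂
  · exact le_trans (mul_nonpos_of_nonpos_of_nonneg (by linarith) hS) hR
  · have hp : g₁ * g₂ < x := not_le.1 hp
    have hxg : 0 < x - g₁ * g₂ := by linarith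
    have h1 : (x - g₁ * g₂) * S ≤ (x - g₁ * g₂) * (κ₁ * D + κ₂ * E) := mul_le_mul_of_nonneg_left hcred hxg.le
    have tD := tfp_termD_heavy x g₁ g₂ κ₁ hx0.le hg₁ hκ₁ (by linarith) hp.le
    have tE := tfp_termD_heavy x g₂ g₁ κ₂ hx0.le hg₂ hκ₂ (by linarith) (by rw [mul_comm]; exact hp.le)
    have tD' := mul_le_mul_of_nonneg_right tD hD
    have tE' := mul_le_mul_of_nonneg_right tE hE
    have e : (x - g₁ * g₂) * (κ₁ * D + κ₂ * E) = (x - g₁ * g₂) * κ₁ * D + (x - g₂ * g₁) * κ₂ * E := by ring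
    rw [e] at h1
    nlinarith

/-- **TFP, light ⊗ light** (`x² ≤ gᵢ ≤ x`, `(1−x)κᵢ ≤ gᵢ − x²`): termwise. [this work] -/
theorem tfp_core_LL (x g₁ g₂ κ₁ κ₂ S D E : ℝ) (hx0 : 0 < x) (hx1 : x < 1) (hg₁ : x ^ 2 ≤ g₁) (hg₁x : g₁ ≤ x) (hg₂ : x ^ 2 ≤ g₂)
    (hg₂x : g₂ ≤ x) (hκ₁ : (1 - x) * κ₁ ≤ g₁ - x ^ 2) (hκ₂ : (1 - x) * κ₂ ≤ g₂ - x ^ 2) (hD : 0 ≤ D) (hE : 0 ≤ E) (_hS : 0 ≤ S)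
    (hcred : S ≤ κ₁ * D + κ₂ * E) :
    (x - g₁ * g₂) * S ≤ x * (g₁ * (1 - g₂) * D + (1 - g₁) * g₂ * E) := by
  have hg₁0 : 0 ≤ g₁ := le_trans (sq_nonneg x) hg₁
  have hg₂0 : 0 ≤ g₂ := le_trans (sq_nonneg x) hg₂
  have hxg : 0 ≤ x - g₁ * g₂ := by nlinarith
  have h1 : (x - g₁ * g₂) * S ≤ (x - g₁ * g₂) * (κ₁ * D + κ₂ * E) := mul_le_mul_of_nonneg_left hcred hxg
  have tD := tfp_termD_light x g₁ g₂ κ₁ hx0 hx1 hg₁ hg₁x hg₂0 hg₂x hκ₁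
  have tE := tfp_termD_light x g₂ g₁ κ₂ hx0 hx1 hg₂ hg₂x hg₁0 hg₁x hκ₂
  have tD' := mul_le_mul_of_nonneg_right tD hD
  have tE' := mul_le_mul_of_nonneg_right tE hE
  have e : (x - g₁ * g₂) * (κ₁ * D + κ₂ * E) = (x - g₁ * g₂) * κ₁ * D + (x - g₂ * g₁) * κ₂ * E := by ring
  rw [e] at h1
  nlinarith

/-- **TFP, light ⊗ heavy** (`x² ≤ g₁ ≤ x ≤ g₂ ≤ 1`), using the regime bound `x·D ≤ S` (the raised rate into the heavy pair's head is not
light): the E-term has slack `g₁g₂(g₂ − x)·E`, the D-term deficit is at most `(x − g₁)(g₁g₂ − x²)/(1−x)·D`, and `x·D ≤ S ≤ κ₁D + g₂E` gives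
`(x − g₁)·D ≤ (1−x)·g₂·E`. [this work] -/
theorem tfp_core_LH (x g₁ g₂ κ₁ κ₂ S D E : ℝ) (hx0 : 0 < x) (hx1 : x < 1) (hg₁ : x ^ 2 ≤ g₁) (hg₁x : g₁ ≤ x) (hg₂ : x ≤ g₂)
    (hg₂1 : g₂ ≤ 1) (hκ₁ : (1 - x) * κ₁ ≤ g₁ - x ^ 2) (hκ₂ : κ₂ ≤ g₂) (hD : 0 ≤ D) (hE : 0 ≤ E) (hS : 0 ≤ S)
    (hcred : S ≤ κ₁ * D + κ₂ * E) (hreg : x * D ≤ S) :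
    (x - g₁ * g₂) * S ≤ x * (g₁ * (1 - g₂) * D + (1 - g₁) * g₂ * E) := by
  have hg₁0 : 0 ≤ g₁ := le_trans (sq_nonneg x) hg₁
  have hg₂0 : 0 ≤ g₂ := by linarith
  have hR : 0 ≤ x * (g₁ * (1 - g₂) * D + (1 - g₁) * g₂ * E) :=
    mul_nonneg hx0.le (add_nonneg (mul_nonneg (mul_nonneg hg₁0 (by linarith)) hD)
      (mul_nonneg (mul_nonneg (by linarith) hg₂0) hE))
  by_cases hp : x ≤ g₁ * g₂
  · exact le_trans (mul_nonpos_of_nonpos_of_nonneg (by linarith) hS) hR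
  have hp : g₁ * g₂ < x := not_le.1 hp
  have hxg : 0 < x - g₁ * g₂ := by linarith
  -- replace S by its credit bound with κ₂ ≤ g₂
  have hcred' : S ≤ κ₁ * D + g₂ * E := le_trans hcred (by nlinarith [mul_le_mul_of_nonneg_right hκ₂ hE])
  have h1 : (x - g₁ * g₂) * S ≤ (x - g₁ * g₂) * (κ₁ * D + g₂ * E) := mul_le_mul_of_nonneg_left hcred' hxg.le
  -- the span bound from the regime: (1−x)·x·D ≤ (1−x)S ≤ (g₁ − x²)D + (1−x)g₂E  ⟹ (x − g₁)·D ≤ (1−x)g₂·E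
  have hspan : (x - g₁) * D ≤ (1 - x) * (g₂ * E) := by
    have a1 : (1 - x) * (x * D) ≤ (1 - x) * S := mul_le_mul_of_nonneg_left hreg (by linarith)
    have a2 : (1 - x) * S ≤ (1 - x) * (κ₁ * D + g₂ * E) := mul_le_mul_of_nonneg_left hcred' (by linarith)
    have a3 : (1 - x) * (κ₁ * D) ≤ (g₁ - x ^ 2) * D := by
      have := mul_le_mul_of_nonneg_right hκ₁ hD; linarith [this]
    nlinarith
  -- D-term: (1−x)(x − g₁g₂)κ₁ ≤ (x − g₁g₂)(g₁ − x²) = x(1−x)g₁(1−g₂) − (x − g₁)(x² − g₁g₂)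
  have key : x * (1 - x) * (g₁ * (1 - g₂)) - (x - g₁ * g₂) * (g₁ - x ^ 2) = (x - g₁) * (x ^ 2 - g₁ * g₂) := by ring
  have dterm : (1 - x) * ((x - g₁ * g₂) * κ₁ * D) ≤ (x * (1 - x) * (g₁ * (1 - g₂)) + (x - g₁) * (g₁ * g₂ - x ^ 2)) * D := by
    have b1 : (1 - x) * ((x - g₁ * g₂) * κ₁) ≤ (x - g₁ * g₂) * (g₁ - x ^ 2) := by
      have := mul_le_mul_of_nonneg_left hκ₁ hxg.le; linarith [this]
    have b2 := mul_le_mul_of_nonneg_right b1 hD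
    have e2 : (x - g₁ * g₂) * (g₁ - x ^ 2) = x * (1 - x) * (g₁ * (1 - g₂)) + (x - g₁) * (g₁ * g₂ - x ^ 2) := by linarith [key]
    rw [e2] at b2
    linarith [b2]
  -- E-term slack: x(1−g₁)g₂ − (x − g₁g₂)g₂ = g₁g₂(g₂ − x)
  have eterm : (x - g₁ * g₂) * g₂ * E = (x * ((1 - g₁) * g₂) - g₁ * g₂ * (g₂ - x)) * E := by ring
  -- the deficit (x − g₁)(g₁g₂ − x²)D is paid by the slack: (x−g₁)D ≤ (1−x)g₂E and g₁g₂ − x² ≤ g₁(g₂ − x)... all times (1−x)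
  have pay : (x - g₁) * (g₁ * g₂ - x ^ 2) * D ≤ (1 - x) * (g₁ * g₂ * (g₂ - x)) * E := by
    have rhs0 : 0 ≤ (1 - x) * (g₁ * g₂ * (g₂ - x)) * E :=
      mul_nonneg (mul_nonneg (by linarith) (mul_nonneg (mul_nonneg hg₁0 hg₂0) (by linarith))) hE
    by_cases hc : g₁ * g₂ - x ^ 2 ≤ 0
    · exact le_trans (mul_nonpos_of_nonpos_of_nonneg (mul_nonpos_of_nonneg_of_nonpos (by linarith) hc) hD) rhs0
    · have c1 : 0 ≤ g₁ * g₂ - x ^ 2 := le_of_lt (not_le.1 hc)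
      have c2 : (x - g₁) * D * (g₁ * g₂ - x ^ 2) ≤ (1 - x) * (g₂ * E) * (g₁ * g₂ - x ^ 2) :=
        mul_le_mul_of_nonneg_right hspan c1
      have c3 : g₁ * g₂ - x ^ 2 ≤ g₁ * (g₂ - x) := by nlinarith
      have c4 : (1 - x) * (g₂ * E) * (g₁ * g₂ - x ^ 2) ≤ (1 - x) * (g₂ * E) * (g₁ * (g₂ - x)) :=
        mul_le_mul_of_nonneg_left c3 (mul_nonneg (by linarith) (mul_nonneg hg₂0 hE))
      nlinarith
  -- assemble: (1−x)·LHS ≤ (1−x)·RHS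
  have total : (1 - x) * ((x - g₁ * g₂) * (κ₁ * D + g₂ * E)) ≤ (1 - x) * (x * (g₁ * (1 - g₂) * D + (1 - g₁) * g₂ * E)) := by
    have e3 : (1 - x) * ((x - g₁ * g₂) * (κ₁ * D + g₂ * E))
        = (1 - x) * ((x - g₁ * g₂) * κ₁ * D) + (1 - x) * ((x - g₁ * g₂) * g₂ * E) := by ring
    rw [e3, eterm]
    nlinarith
  have h2 : (x - g₁ * g₂) * (κ₁ * D + g₂ * E) ≤ x * (g₁ * (1 - g₂) * D + (1 - g₁) * g₂ * E) :=
    le_of_mul_le_mul_left total (by linarith)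
  exact h1.trans h2

/-- **TFP, heavy ⊗ light** — the mirror image of `tfp_core_LH` (swap the roles of the two pairs), using `x·E ≤ S`. [this work] -/
theorem tfp_core_HL (x g₁ g₂ κ₁ κ₂ S D E : ℝ) (hx0 : 0 < x) (hx1 : x < 1) (hg₁ : x ≤ g₁) (hg₁1 : g₁ ≤ 1) (hg₂ : x ^ 2 ≤ g₂)
    (hg₂x : g₂ ≤ x) (hκ₁ : κ₁ ≤ g₁) (hκ₂ : (1 - x) * κ₂ ≤ g₂ - x ^ 2) (hD : 0 ≤ D) (hE : 0 ≤ E) (hS : 0 ≤ S)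
    (hcred : S ≤ κ₁ * D + κ₂ * E) (hreg : x * E ≤ S) :
    (x - g₁ * g₂) * S ≤ x * (g₁ * (1 - g₂) * D + (1 - g₁) * g₂ * E) := by
  have h := tfp_core_LH x g₂ g₁ κ₂ κ₁ S E D hx0 hx1 hg₂ hg₂x hg₁ hg₁1 hκ₂ hκ₁ hE hD hS (by linarith) hreg
  have e1 : g₂ * g₁ = g₁ * g₂ := mul_comm _ _
  rw [e1] at h
  linarith

/-- **TFP — THE TOP-FLIPPED PIECE INEQUALITY, all four type pairs** (`0 < x < 1`; gates `x² ≤ gᵢ ≤ 1`; credit rates `κᵢ ≤ κ_x(gᵢ)`, i.e.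
`κᵢ ≤ gᵢ` and `(1−x)κᵢ ≤ gᵢ − x²`; spans `D, E ≥ 0`; deficit `0 ≤ S ≤ κ₁D + κ₂E`; regime: no light raised rate, `xD ≤ S`, `xE ≤ S`):
`(x − g₁g₂)·S ≤ x·(g₁(1−g₂)D + (1−g₁)g₂E)`.  Equality at `g₁ = g₂ = x`, `S = x(D+E)`. [this work] -/
theorem tfp_core (x g₁ g₂ κ₁ κ₂ S D E : ℝ) (hx0 : 0 < x) (hx1 : x < 1) (hg₁ : x ^ 2 ≤ g₁) (hg₁1 : g₁ ≤ 1) (hg₂ : x ^ 2 ≤ g₂)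
    (hg₂1 : g₂ ≤ 1) (hκ₁ : κ₁ ≤ g₁) (hκ₁' : (1 - x) * κ₁ ≤ g₁ - x ^ 2) (hκ₂ : κ₂ ≤ g₂) (hκ₂' : (1 - x) * κ₂ ≤ g₂ - x ^ 2)
    (hD : 0 ≤ D) (hE : 0 ≤ E) (hS : 0 ≤ S) (hcred : S ≤ κ₁ * D + κ₂ * E) (hregD : x * D ≤ S) (hregE : x * E ≤ S) :
    (x - g₁ * g₂) * S ≤ x * (g₁ * (1 - g₂) * D + (1 - g₁) * g₂ * E) := by
  by_cases h1 : x ≤ g₁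
  · by_cases h2 : x ≤ g₂
    · exact tfp_core_HH x g₁ g₂ κ₁ κ₂ S D E hx0 h1 hg₁1 h2 hg₂1 hκ₁ hκ₂ hD hE hS hcred
    · exact tfp_core_HL x g₁ g₂ κ₁ κ₂ S D E hx0 hx1 h1 hg₁1 hg₂ (le_of_lt (not_le.1 h2)) hκ₁ hκ₂' hD hE hS hcred hregE
  · by_cases h2 : x ≤ g₂
    · exact tfp_core_LH x g₁ g₂ κ₁ κ₂ S D E hx0 hx1 hg₁ (le_of_lt (not_le.1 h1)) h2 hg₂1 hκ₁' hκ₂ hD hE hS hcred hregD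
    · exact tfp_core_LL x g₁ g₂ κ₁ κ₂ S D E hx0 hx1 hg₁ (le_of_lt (not_le.1 h1)) hg₂ (le_of_lt (not_le.1 h2)) hκ₁' hκ₂' hD hE hS hcred

/-! ### The giant budget of the retained flow -/

/-- **THE GIANT BUDGET FROM TFP.**  For `0 < x < 1`, `0 < S < D`, `S < E` (both raised pairs compatible): the retained flow ships
`g₁(1−g₂)(D−S)/S` of the low cell into the mid `a′+b` and `(1−g₁)g₂(E−S)/S` into `a+b′`; the remainder fits the giant `g₁g₂` at rate `x/(1−x)`:
`(x/(1−x))·((1−g₁)(1−g₂) − g₁(1−g₂)(D−S)/S − (1−g₁)g₂(E−S)/S) ≤ g₁g₂` ⟸ TFP. [this work] -/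
theorem tfp_giant_budget_of_core (x g₁ g₂ S D E : ℝ) (hx1 : x < 1) (hS : 0 < S)
    (hcore : (x - g₁ * g₂) * S ≤ x * (g₁ * (1 - g₂) * D + (1 - g₁) * g₂ * E)) :
    x / (1 - x) * ((1 - g₁) * (1 - g₂) - g₁ * (1 - g₂) * (D - S) / S - (1 - g₁) * g₂ * (E - S) / S) ≤ g₁ * g₂ := by
  have h1x : 0 < 1 - x := by linarith
  have hSne : S ≠ 0 := ne_of_gt hS
  rw [div_mul_eq_mul_div, div_le_iff₀ h1x]
  -- clear the divisions by S
  have e : x * ((1 - g₁) * (1 - g₂) - g₁ * (1 - g₂) * (D - S) / S - (1 - g₁) * g₂ * (E - S) / S)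
      = ((x - g₁ * g₂) * S + (1 - x) * (g₁ * g₂) * S - x * (g₁ * (1 - g₂) * D + (1 - g₁) * g₂ * E)) / S := by
    rw [eq_div_iff hSne]
    field_simp
    ring
  rw [e, div_le_iff₀ hS]
  linarith [hcore]

/-! ### The giant budget when a raised pair is incompatible (appended) -/

/-- **giant budget, the pair into `a′+b` incompatible (`D ≤ S`)**: nothing is shipped into that mid, and TFP still pays the giant:
`(x/(1−x))·((1−g₁)(1−g₂) − (1−g₁)g₂(E−S)/S) ≤ g₁g₂` (`0 ≤ x`, `0 ≤ g₁`, `g₂ ≤ 1`). [this work] -/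
theorem tfp_giant_budget_dropD (x g₁ g₂ S D E : ℝ) (hx0 : 0 ≤ x) (hx1 : x < 1) (hS : 0 < S) (hg₁ : 0 ≤ g₁) (hg₂ : g₂ ≤ 1) (hDS : D ≤ S)
    (hcore : (x - g₁ * g₂) * S ≤ x * (g₁ * (1 - g₂) * D + (1 - g₁) * g₂ * E)) :
    x / (1 - x) * ((1 - g₁) * (1 - g₂) - (1 - g₁) * g₂ * (E - S) / S) ≤ g₁ * g₂ := by
  have h1x : 0 < 1 - x := by linarith
  have hSne : S ≠ 0 := ne_of_gt hS
  rw [div_mul_eq_mul_div, div_le_iff₀ h1x]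
  have e : x * ((1 - g₁) * (1 - g₂) - (1 - g₁) * g₂ * (E - S) / S)
      = (x * ((1 - g₁) * (1 - g₂)) * S + x * ((1 - g₁) * g₂) * S - x * ((1 - g₁) * g₂ * E)) / S := by
    rw [eq_div_iff hSne]
    field_simp
    ring
  rw [e, div_le_iff₀ hS]
  have hmono : x * (g₁ * (1 - g₂) * D) ≤ x * (g₁ * (1 - g₂) * S) :=
    mul_le_mul_of_nonneg_left (mul_le_mul_of_nonneg_left hDS (mul_nonneg hg₁ (by linarith))) hx0
  nlinarith [hcore, hmono]

/-- **giant budget, the pair into `a+b′` incompatible (`E ≤ S`)** — mirror image. [this work] -/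
theorem tfp_giant_budget_dropE (x g₁ g₂ S D E : ℝ) (hx0 : 0 ≤ x) (hx1 : x < 1) (hS : 0 < S) (hg₂ : 0 ≤ g₂) (hg₁ : g₁ ≤ 1) (hES : E ≤ S)
    (hcore : (x - g₁ * g₂) * S ≤ x * (g₁ * (1 - g₂) * D + (1 - g₁) * g₂ * E)) :
    x / (1 - x) * ((1 - g₁) * (1 - g₂) - g₁ * (1 - g₂) * (D - S) / S) ≤ g₁ * g₂ := by
  have hcore' : (x - g₂ * g₁) * S ≤ x * (g₂ * (1 - g₁) * E + (1 - g₂) * g₁ * D) := by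
    have e1 : g₂ * g₁ = g₁ * g₂ := mul_comm _ _
    rw [e1]; linarith
  have h := tfp_giant_budget_dropD x g₂ g₁ S E D hx0 hx1 hS hg₂ hg₁ hES hcore'
  have e2 : (1 - g₂) * (1 - g₁) - (1 - g₂) * g₁ * (D - S) / S = (1 - g₁) * (1 - g₂) - g₁ * (1 - g₂) * (D - S) / S := by ring
  rw [e2, mul_comm g₂ g₁] at h
  exact h

/-- **giant budget, both raised pairs incompatible (`D ≤ S`, `E ≤ S`)**: the whole low cell rides the giant,
`(x/(1−x))·(1−g₁)(1−g₂) ≤ g₁g₂`. [this work] -/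
theorem tfp_giant_budget_dropDE (x g₁ g₂ S D E : ℝ) (hx0 : 0 ≤ x) (hx1 : x < 1) (hS : 0 < S) (hg₁0 : 0 ≤ g₁) (hg₁1 : g₁ ≤ 1)
    (hg₂0 : 0 ≤ g₂) (hg₂1 : g₂ ≤ 1) (hDS : D ≤ S) (hES : E ≤ S)
    (hcore : (x - g₁ * g₂) * S ≤ x * (g₁ * (1 - g₂) * D + (1 - g₁) * g₂ * E)) :
    x / (1 - x) * ((1 - g₁) * (1 - g₂)) ≤ g₁ * g₂ := by
  have h1x : 0 < 1 - x := by linarith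
  rw [div_mul_eq_mul_div, div_le_iff₀ h1x]
  have hmono : x * (g₁ * (1 - g₂) * D + (1 - g₁) * g₂ * E) ≤ x * (g₁ * (1 - g₂) * S + (1 - g₁) * g₂ * S) :=
    mul_le_mul_of_nonneg_left (add_le_add (mul_le_mul_of_nonneg_left hDS (mul_nonneg hg₁0 (by linarith)))
      (mul_le_mul_of_nonneg_left hES (mul_nonneg (by linarith) hg₂0))) hx0
  -- (x − g₁g₂)S ≤ x(g₁(1−g₂) + (1−g₁)g₂)S  ⟹  divide by S > 0
  have h3 : (x - g₁ * g₂) * S ≤ x * (g₁ * (1 - g₂) + (1 - g₁) * g₂) * S := by nlinarith [hcore, hmono]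
  have h4 : x - g₁ * g₂ ≤ x * (g₁ * (1 - g₂) + (1 - g₁) * g₂) := le_of_mul_le_mul_right h3 hS
  nlinarith [h4]

end LawDec

end Quant

end Summit.CriticalPhenomena.PercolationContinuityZ3.Theorems
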